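import Summits.CriticalPhenomena.CardyFormulaZ2.Theorems.CardyComplexConeParafermionToSLESixFamiliesDiamondBoundaryIdentification
import HarnessLib

/-!
# Line `potential-darboux-picard-diamond`, stub S4′ (`stub_identifyPotentialPh`) — CLOSED

Crux `ParafermionToSLESixFamilies` (stmt-CriticalPhenomena-11389), lead c5. The registered stub S4′ of skeleton r2,
`stub_identifyPotentialPh : ExactPotentialTracePh → (DarbouxPicardConvex ∧ TraceWindingNonneg) → ClosedPrecompactness →
PotentialConformalLimit` (THE ENGINE APPLIED: N + I on marked diamonds), follows from the landed S4v
`stub_boundaryIdentification : BoundaryIdentification` (p151443, wave 3) through the landed assembly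
`potentialConformalLimit_of_identify` (p144695, wave 2) — packaged as the registered glue
`identifyPotentialPh_of_boundaryIdentification` (`…DiamondDefsR3.lean`, p145738). Nothing else here.
-/

noncomputable section

namespace Summit.CriticalPhenomena.CardyFormulaZ2.Cruxes.ParafermionToSLESixFamilies.PotentialDarbouxPicardDiamond

/-- **S4′ (registered stub of skeleton r2), closed**: Arzelà–Ascoli on the closed diamond, the left-turning limit polygon,
Darboux–Picard through the Riemann map, and the boundary identification `(G′)³ = c·ψ′/ψ` — all landed; this is the
composition `identifyPotentialPh_of_boundaryIdentification stub_boundaryIdentification`. -/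
theorem stub_identifyPotentialPh :
    ExactPotentialTracePh → (DarbouxPicardConvex ∧ TraceWindingNonneg) → ClosedPrecompactness → PotentialConformalLimit :=
  identifyPotentialPh_of_boundaryIdentification stub_boundaryIdentification

end Summit.CriticalPhenomena.CardyFormulaZ2.Cruxes.ParafermionToSLESixFamilies.PotentialDarbouxPicardDiamond

end
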